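import Literature.Barriers.ValiantsHypothesis.MonotoneGapMatrixTree
import Literature.Computability.AlgebraicComplexity.DetInVP
import HarnessLib

/-!
# The monotone gap, general-circuit side: `ST ∈ VP` (discharge of `isVPFamily_stPoly`)

Discharge (D-0014) of the named fact
`Literature.Barriers.ValiantsHypothesis.isVPFamily_stPoly` of the barrier entry
`MonotoneGap.lean`: over every field `F`, Jerrum–Snir's directed spanning tree polynomial
`(stPoly F N)_N` (§4.5) is a `VP` family. This is the "power of negation" half of the monotone
gap (Jerrum–Snir 1982, §5.1, p. 893): "if negative constants are allowed, the same polynomial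
can be expressed as an `n × n` determinant whose elements are linear combinations of the
indeterminates [13], and this determinant can then be evaluated (without divisions) in
`O(n^{3.52})` multiplications using the method of Strassen" — here: the determinant is the tree's
directed matrix-tree theorem `det_stLaplacian` (`MonotoneGapMatrixTree.lean`), the division-free
evaluation is Berkowitz's algorithm as proved in the tree (`complexity_detPoly_le`,
`DetInVP.lean`: `L(DET_N) ≤ 8 (N+1)^7`), and the linear substitution costs `≤ N` gates per entry
(`complexity_aeval_le`, Bürgisser 2000, Rem. 2.7). Altogether `L(ST) ≤ 8 (N+1)^7 + N³`
(`complexity_stPoly_le`), `N (N+1)` variables, degree `≤ N`: `isVPFamily_stPoly_holds`.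

## References

* [JerrumSnir1982] M. Jerrum, M. Snir, J. ACM 29 (1982) 874–897, §4.5 and §5.1 (p. 893).
* [Burgisser2000] P. Bürgisser, *Completeness and Reduction in Algebraic Complexity Theory*,
  Springer 2000, Rem. 2.7 (substitution), Prop. 2.30 (`DET ∈ VP`).
-/

noncomputable section

namespace Literature.Barriers.ValiantsHypothesis

open MvPolynomial Finset Literature.Computability.AlgebraicComplexity

universe u

variable (R : Type u) [CommRing R] (N : ℕ)

/-- `ST` is the image of the generic determinant `DET_N` under the linear substitution
`X_{ij} ↦ L_{ij}` by the entries of the reduced Laplacian (matrix-tree theorem).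
[cite: JerrumSnir1982, §5.1] -/
theorem stPoly_eq_aeval_detPoly :
    stPoly R N = aeval (fun p : Fin N × Fin N => stLaplacian R N p.1 p.2) (detPoly (Fin N) R) := by
  rw [detPoly, AlgHom.map_det, AlgHom.mapMatrix_apply, ← det_stLaplacian]
  congr 1
  ext i j
  simp [Matrix.mvPolynomialX]

/-- Each entry of the reduced Laplacian costs at most `N` gates (a sum of `N` variables, or one
negation). [cite: Burgisser2000, Rem. 2.7] -/
theorem complexity_stLaplacian_le (i j : Fin N) : complexity (stLaplacian R N i j) ≤ N := by
  by_cases h : i = j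
  · subst h
    rw [stLaplacian_apply_self]
    refine (complexity_finset_sum_le _ _).trans ?_
    have h0 : ∀ v ∈ univ.erase (some i), complexity (X (i, v) : MvPolynomial _ R) = 0 :=
      fun v _ => complexity_X_holds _
    rw [Finset.sum_eq_zero h0, zero_add, Finset.card_erase_of_mem (Finset.mem_univ _),
      Finset.card_univ, Fintype.card_option, Fintype.card_fin, Nat.add_sub_cancel]
  · rw [stLaplacian_apply_of_ne h]
    refine (complexity_neg_le _).trans ?_
    rw [complexity_X_holds]
    have := i.pos
    omega

/-- **`L(ST_N) ≤ 8 (N+1)^7 + N³`**: Berkowitz's determinant circuit composed with the linear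
substitution of the matrix-tree theorem ("an `n × n` determinant whose elements are linear
combinations of the indeterminates ... evaluated without divisions").
[cite: JerrumSnir1982, §5.1] -/
theorem complexity_stPoly_le : complexity (stPoly R N) ≤ 8 * (N + 1) ^ 7 + N ^ 2 * N := by
  rw [stPoly_eq_aeval_detPoly]
  refine (complexity_aeval_le _ _).trans (Nat.add_le_add (complexity_detPoly_le R N) ?_)
  calc ∑ p : Fin N × Fin N, complexity (stLaplacian R N p.1 p.2)
      ≤ ∑ _p : Fin N × Fin N, N := Finset.sum_le_sum fun p _ => complexity_stLaplacian_le R N p.1 p.2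
    _ = N ^ 2 * N := by simp [sq]

/-- **Discharge of `isVPFamily_stPoly`: `ST ∈ VP` over every field** (Jerrum–Snir 1982, §5.1;
the general-circuit side of the monotone gap): `N (N+1)` variables, degree `≤ N`, complexity
`≤ 8 (N+1)^7 + N³ ≤ 9 (N+1)^7`. [cite: JerrumSnir1982, §5.1] -/
theorem isVPFamily_stPoly_holds : isVPFamily_stPoly := by
  intro F _
  refine ⟨⟨(IsPBounded.iff_exists_le_mul_succ_pow _).2 ⟨1, 2, fun N => ?_⟩,
    (IsPBounded.iff_exists_le_mul_succ_pow _).2 ⟨1, 1, fun N => ?_⟩⟩,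
    (IsPBounded.iff_exists_le_mul_succ_pow _).2 ⟨9, 7, fun N => ?_⟩⟩
  · simp only [Fintype.card_prod, Fintype.card_fin, Fintype.card_option]
    nlinarith
  · exact (totalDegree_stPoly_le F N).trans (by simp)
  · refine (complexity_stPoly_le F N).trans ?_
    have h : N ^ 2 * N ≤ (N + 1) ^ 7 :=
      calc N ^ 2 * N = N ^ 3 := by ring
        _ ≤ (N + 1) ^ 3 := Nat.pow_le_pow_left (Nat.le_succ N) 3
        _ ≤ (N + 1) ^ 7 := Nat.pow_le_pow_right (Nat.succ_pos N) (by norm_num)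
    omega

/-- With `ST ∈ VP` proved, the no-go theorem of the barrier entry needs only the monotone lower
bound: `JerrumSnir1982_spanningTree → ¬ MonotoneLowerBoundsTransfer`.
[cite: JerrumSnir1982, §4.5 and §5.1] -/
theorem not_monotoneLowerBoundsTransfer_of_lower (hst : JerrumSnir1982_spanningTree) :
    ¬ MonotoneLowerBoundsTransfer :=
  not_monotoneLowerBoundsTransfer hst isVPFamily_stPoly_holds

end Literature.Barriers.ValiantsHypothesis
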